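import Summits.NavierStokesRegularity.FluidComputer.PalasekTowerLiveClassAt
import Summits.NavierStokesRegularity.FluidComputer.PalasekTowerHeredityWitnessUnconditional

/-!
# The LIVE-CLASS repair inherits the sub-floor obstruction verbatim: a sub-floor competitor EMPTIES the next level of
# its design, so a LIVE registered stage with a sub-floor competitor refutes `LiveHeredityAtGAt R k` /
# `LiveHeredityFromGAt R k₀` exactly as it refutes the items

Cell `ns-blowup`, seat `ns-blowup-refuter4` (g10, K209; ledger refuter of record for route `PalasekTowerBreakdown` rev 19,
items 20304 `HeredityAtOneT` / 20305 `HeredityFromTwoT`). Negative-lane lemmas (`Theorems/<Crux>/Negative/`) on fc-prover-2's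
shelf vocabulary `PalasekTowerLiveClassAt.lean` (p530059: `DeadSlice`, `LiveStageAt`, `LiveHeredityAtGAt`, `LiveHeredityFromGAt`,
the repaired closer `closes_repairAt`). Theorems only (the witness is carried as explicit binders — no `Prop` introduced); no
Theses statement asserted or denied; nothing about Navier–Stokes decided. LABEL: refuter kernel certificate (E–C typing). WHAT
THIS IS NOT: not NS evidence — `¬(repaired heredity)` FROM a witness (live stage + sub-floor competitor) nobody has exhibited.

* §1 `no_stage_succ_of_subfloor_competitor` — the MECHANISM behind every sub-floor negative of record (g9: p525716
  `not_heredityAtGAt_of_subfloorStageGAt`, p529355, p530280), isolated: if a design `S` on rates `R` carries a registered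
  level-`k` stage `s` and a finite-energy classical solution `u` of its system on `[0, τ_{k+1}]` from the datum whose speed at
  `τ_{k+1}` is `< c₁ Y_{k+1}` throughout the readout ball, then `S` has NO registered level-`(k+1)` stage AT ALL (any such
  stage is bounded by its window ceiling, hence equals `u` by forced Serrin–Masuda weak–strong uniqueness
  `Stage.velocity_eq_of_window_ceiling`, and then misses its own speed floor). Heredity — plain or live — is refuted a fortiori.
* §2 the witness `H_sub^live(R, k)` = g9's `SubfloorStageGAt R k` with the registered level-`k` stage asked LIVE
  (`LiveStageAt R S s`: its hand-over slice is not axisymmetric-swirl-free in any rigid placement — an open, generic condition),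
  carried as explicit binders: `not_liveHeredityAtGAt_of_live_subfloor`, `not_liveHeredityFromGAt_of_live_subfloor` (`k₀ ≤ k`),
  the repaired pair, and the plain items too (`not_heredityAtGAt_of_live_subfloor`, `…From…`); §3 tuned instances against the
  shelf abbreviations `LiveHeredityAtOneT`, `LiveHeredityFromTwoT`.

READING (planner g23+ / fc-prover-2 / LEAD 20303): the live-class repair answers EXACTLY the sterile instrument (cstrat
«mirrorT»: an axisymmetric swirl-free registered stage) and nothing else — every tame-miss / sub-floor witness of record
(K207: Kato-small fillers never double their speed; thin filaments diffusing inside the window; p530280's five-face misses)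
is generically LIVE, so `LiveHeredityAtGAt R k` is still the global claim "every non-symmetric registered level-`k` stage of
every pinned rigid quiet design reaches all level-`(k+1)` floors". References: S. Palasek, arXiv:2605.13827 §4
[cite: Palasek2026ElementaryModel, §4]; H. Sohr, *The Navier–Stokes Equations* (2001), Ch. V Thm. 1.5.1
[cite: Sohr2001, Ch. V Thm. 1.5.1].
-/

noncomputable section

namespace Summit.NavierStokesRegularity.HeredityAtOneTLiveSubfloor

open Set MeasureTheory
open scoped ENNReal NNReal
open Literature.Analysis.FluidPDE
open Summit.NavierStokesRegularity.FluidComputer.PalasekTowerClayBridge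

/-! ## §1 A sub-floor competitor empties the next level of its design -/

/-- **A SUB-FLOOR COMPETITOR EMPTIES THE NEXT LEVEL.** If the design `S` (rates `R`, unit viscosity, route margins) has a
registered level-`k` stage and a finite-energy classical solution `u` of its forced system on `[0, τ_{k+1}]` from the datum
whose speed at `τ_{k+1}` is below `c₁ Y_{k+1}` on the readout ball, then `S` has no registered level-`(k+1)` stage.
[cite: Sohr2001, Ch. V Thm. 1.5.1] -/
theorem no_stage_succ_of_subfloor_competitor {R : TowerRates} {S : Schedule R} {k : ℕ}
    (s : Stage 1 R S (Margins.routeG R) k)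
    {u : ℝ → EuclideanSpace ℝ (Fin 3) → EuclideanSpace ℝ (Fin 3)} {p : ℝ → EuclideanSpace ℝ (Fin 3) → ℝ}
    (hcl : IsClassicalNSSolutionOn (Icc 0 (S.τ (k + 1))) 1 S.f u p) (hu0 : u 0 = S.u₀)
    (hE : ∃ C : ℝ≥0∞, C < ⊤ ∧ ∀ t ∈ Icc 0 (S.τ (k + 1)), ∫⁻ x, ‖u t x‖ₑ ^ 2 ≤ C)
    (hsub : ∀ x, ‖x‖ ≤ S.radius → ‖u (S.τ (k + 1)) x‖ < S.c₁ * R.Y (k + 1))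
    (s' : Stage 1 R S (Margins.routeG R) (k + 1)) : False := by
  have hceil' : ∀ t ∈ Icc (S.τ k) (S.τ (k + 1)), ∀ x, ‖s'.u t x‖ ≤ S.c₂ * R.Y (k + 1) :=
    fun t ht x => s'.ceiling (k + 1) le_rfl t ⟨(S.τ_pos k).le.trans ht.1, ht.2⟩ x
  have heq : ∀ t ∈ Icc 0 (S.τ (k + 1)), u t = s'.u t :=
    s.velocity_eq_of_window_ceiling one_pos s'.classical s'.initial s'.energy hceil' hcl hu0 hE
  obtain ⟨x, hx, hfl⟩ := s'.floor (k + 1) le_rfl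
  have h1 := hsub x hx
  rw [heq _ ⟨(S.τ_pos (k + 1)).le, le_rfl⟩] at h1
  exact absurd hfl (not_le.2 h1)

/-- Corollary: under a sub-floor competitor the level `k + 1` of the design is EMPTY as a type. [cite: Sohr2001, Ch. V Thm. 1.5.1] -/
theorem isEmpty_stage_succ_of_subfloor_competitor {R : TowerRates} {S : Schedule R} {k : ℕ}
    (s : Stage 1 R S (Margins.routeG R) k)
    {u : ℝ → EuclideanSpace ℝ (Fin 3) → EuclideanSpace ℝ (Fin 3)} {p : ℝ → EuclideanSpace ℝ (Fin 3) → ℝ}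
    (hcl : IsClassicalNSSolutionOn (Icc 0 (S.τ (k + 1))) 1 S.f u p) (hu0 : u 0 = S.u₀)
    (hE : ∃ C : ℝ≥0∞, C < ⊤ ∧ ∀ t ∈ Icc 0 (S.τ (k + 1)), ∫⁻ x, ‖u t x‖ₑ ^ 2 ≤ C)
    (hsub : ∀ x, ‖x‖ ≤ S.radius → ‖u (S.τ (k + 1)) x‖ < S.c₁ * R.Y (k + 1)) :
    IsEmpty (Stage 1 R S (Margins.routeG R) (k + 1)) :=
  ⟨fun s' => no_stage_succ_of_subfloor_competitor s hcl hu0 hE hsub s'⟩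

/-! ## §2 The refutation templates from a LIVE stage with a sub-floor competitor -/

section Witness

variable {R : TowerRates} {S : Schedule R} {k : ℕ}
  {u : ℝ → EuclideanSpace ℝ (Fin 3) → EuclideanSpace ℝ (Fin 3)} {p : ℝ → EuclideanSpace ℝ (Fin 3) → ℝ}

/-- **`H_sub^live(R, k) → ¬ LiveHeredityAtGAt R k`**: a pinned rigid quiet design with a LIVE registered level-`k` stage
and a sub-floor competitor from the datum refutes the repaired heredity — it asks an extension OF the live stage, and §1 says
the design has no level-`(k+1)` stage at all. [cite: Sohr2001, Ch. V Thm. 1.5.1] -/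
theorem not_liveHeredityAtGAt_of_live_subfloor (hP : S.Pins 8 (6 / 5)) (hR : S.Rigid) (hQ : S.Quiet)
    (s : Stage 1 R S (Margins.routeG R) k) (hs : LiveStageAt R S s)
    (hcl : IsClassicalNSSolutionOn (Icc 0 (S.τ (k + 1))) 1 S.f u p) (hu0 : u 0 = S.u₀)
    (hE : ∃ C : ℝ≥0∞, C < ⊤ ∧ ∀ t ∈ Icc 0 (S.τ (k + 1)), ∫⁻ x, ‖u t x‖ₑ ^ 2 ≤ C)
    (hsub : ∀ x, ‖x‖ ≤ S.radius → ‖u (S.τ (k + 1)) x‖ < S.c₁ * R.Y (k + 1)) :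
    ¬ LiveHeredityAtGAt R k := by
  intro h
  obtain ⟨s', -⟩ := h S hP hR hQ s hs
  exact no_stage_succ_of_subfloor_competitor s hcl hu0 hE hsub s'

/-- **`H_sub^live(R, k) → ¬ LiveHeredityFromGAt R k₀`** for every `k₀ ≤ k`. [cite: Sohr2001, Ch. V Thm. 1.5.1] -/
theorem not_liveHeredityFromGAt_of_live_subfloor {k₀ : ℕ} (hk : k₀ ≤ k) (hP : S.Pins 8 (6 / 5)) (hR : S.Rigid)
    (hQ : S.Quiet) (s : Stage 1 R S (Margins.routeG R) k) (hs : LiveStageAt R S s)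
    (hcl : IsClassicalNSSolutionOn (Icc 0 (S.τ (k + 1))) 1 S.f u p) (hu0 : u 0 = S.u₀)
    (hE : ∃ C : ℝ≥0∞, C < ⊤ ∧ ∀ t ∈ Icc 0 (S.τ (k + 1)), ∫⁻ x, ‖u t x‖ₑ ^ 2 ≤ C)
    (hsub : ∀ x, ‖x‖ ≤ S.radius → ‖u (S.τ (k + 1)) x‖ < S.c₁ * R.Y (k + 1)) :
    ¬ LiveHeredityFromGAt R k₀ :=
  fun h => not_liveHeredityAtGAt_of_live_subfloor hP hR hQ s hs hcl hu0 hE hsub (h.liveHeredityAt hk)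

/-- The repaired PAIR fails as soon as some level `k ≥ 1` carries a live stage with a sub-floor competitor (the second /
third binder of `closes_repairAt` is then unavailable). [cite: Sohr2001, Ch. V Thm. 1.5.1] -/
theorem not_liveHeredity_pair_of_live_subfloor (hk : 1 ≤ k) (hP : S.Pins 8 (6 / 5)) (hR : S.Rigid) (hQ : S.Quiet)
    (s : Stage 1 R S (Margins.routeG R) k) (hs : LiveStageAt R S s)
    (hcl : IsClassicalNSSolutionOn (Icc 0 (S.τ (k + 1))) 1 S.f u p) (hu0 : u 0 = S.u₀)
    (hE : ∃ C : ℝ≥0∞, C < ⊤ ∧ ∀ t ∈ Icc 0 (S.τ (k + 1)), ∫⁻ x, ‖u t x‖ₑ ^ 2 ≤ C)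
    (hsub : ∀ x, ‖x‖ ≤ S.radius → ‖u (S.τ (k + 1)) x‖ < S.c₁ * R.Y (k + 1)) :
    ¬ (LiveHeredityAtGAt R 1 ∧ LiveHeredityFromGAt R 2) := by
  rintro ⟨h₁, h₂⟩
  exact not_liveHeredityFromGAt_of_live_subfloor hk hP hR hQ s hs hcl hu0 hE hsub (h₁.liveHeredityFrom h₂)

/-- The same witness refutes the PLAIN item shape (`HeredityAtGAt R k` implies its live repair) — liveness is not even
used: §1 alone does it. [cite: Sohr2001, Ch. V Thm. 1.5.1] -/
theorem not_heredityAtGAt_of_subfloor (hP : S.Pins 8 (6 / 5)) (hR : S.Rigid) (hQ : S.Quiet)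
    (s : Stage 1 R S (Margins.routeG R) k)
    (hcl : IsClassicalNSSolutionOn (Icc 0 (S.τ (k + 1))) 1 S.f u p) (hu0 : u 0 = S.u₀)
    (hE : ∃ C : ℝ≥0∞, C < ⊤ ∧ ∀ t ∈ Icc 0 (S.τ (k + 1)), ∫⁻ x, ‖u t x‖ₑ ^ 2 ≤ C)
    (hsub : ∀ x, ‖x‖ ≤ S.radius → ‖u (S.τ (k + 1)) x‖ < S.c₁ * R.Y (k + 1)) :
    ¬ HeredityAtGAt R k := by
  intro h
  obtain ⟨s', -⟩ := h S hP hR hQ s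
  exact no_stage_succ_of_subfloor_competitor s hcl hu0 hE hsub s'

/-- … and `HeredityFromGAt R k₀`, `k₀ ≤ k`. [cite: Sohr2001, Ch. V Thm. 1.5.1] -/
theorem not_heredityFromGAt_of_subfloor {k₀ : ℕ} (hk : k₀ ≤ k) (hP : S.Pins 8 (6 / 5)) (hR : S.Rigid) (hQ : S.Quiet)
    (s : Stage 1 R S (Margins.routeG R) k)
    (hcl : IsClassicalNSSolutionOn (Icc 0 (S.τ (k + 1))) 1 S.f u p) (hu0 : u 0 = S.u₀)
    (hE : ∃ C : ℝ≥0∞, C < ⊤ ∧ ∀ t ∈ Icc 0 (S.τ (k + 1)), ∫⁻ x, ‖u t x‖ₑ ^ 2 ≤ C)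
    (hsub : ∀ x, ‖x‖ ≤ S.radius → ‖u (S.τ (k + 1)) x‖ < S.c₁ * R.Y (k + 1)) :
    ¬ HeredityFromGAt R k₀ :=
  fun h => not_heredityAtGAt_of_subfloor hP hR hQ s hcl hu0 hE hsub (h.heredityAt hk)

end Witness

/-! ## §3 At the re-based register `TowerRates.tuned` (shelf abbreviations of p530059) -/

section Tuned

variable {S : Schedule TowerRates.tuned} {k : ℕ}
  {u : ℝ → EuclideanSpace ℝ (Fin 3) → EuclideanSpace ℝ (Fin 3)} {p : ℝ → EuclideanSpace ℝ (Fin 3) → ℝ}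

/-- **`H_sub^live(tuned, 1) → ¬ LiveHeredityAtOneT`.** [cite: Sohr2001, Ch. V Thm. 1.5.1] -/
theorem liveHeredityAtOneT_false_of_live_subfloor (hP : S.Pins 8 (6 / 5)) (hR : S.Rigid) (hQ : S.Quiet)
    (s : Stage 1 TowerRates.tuned S (Margins.routeG TowerRates.tuned) 1) (hs : LiveStageAt TowerRates.tuned S s)
    (hcl : IsClassicalNSSolutionOn (Icc 0 (S.τ 2)) 1 S.f u p) (hu0 : u 0 = S.u₀)
    (hE : ∃ C : ℝ≥0∞, C < ⊤ ∧ ∀ t ∈ Icc 0 (S.τ 2), ∫⁻ x, ‖u t x‖ₑ ^ 2 ≤ C)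
    (hsub : ∀ x, ‖x‖ ≤ S.radius → ‖u (S.τ 2) x‖ < S.c₁ * TowerRates.tuned.Y 2) :
    ¬ LiveHeredityAtOneT :=
  not_liveHeredityAtGAt_of_live_subfloor hP hR hQ s hs hcl hu0 hE hsub

/-- **`H_sub^live(tuned, k)`, `k ≥ 2` → ¬ LiveHeredityFromTwoT.** [cite: Sohr2001, Ch. V Thm. 1.5.1] -/
theorem liveHeredityFromTwoT_false_of_live_subfloor (hk : 2 ≤ k) (hP : S.Pins 8 (6 / 5)) (hR : S.Rigid)
    (hQ : S.Quiet) (s : Stage 1 TowerRates.tuned S (Margins.routeG TowerRates.tuned) k)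
    (hs : LiveStageAt TowerRates.tuned S s)
    (hcl : IsClassicalNSSolutionOn (Icc 0 (S.τ (k + 1))) 1 S.f u p) (hu0 : u 0 = S.u₀)
    (hE : ∃ C : ℝ≥0∞, C < ⊤ ∧ ∀ t ∈ Icc 0 (S.τ (k + 1)), ∫⁻ x, ‖u t x‖ₑ ^ 2 ≤ C)
    (hsub : ∀ x, ‖x‖ ≤ S.radius → ‖u (S.τ (k + 1)) x‖ < S.c₁ * TowerRates.tuned.Y (k + 1)) :
    ¬ LiveHeredityFromTwoT :=
  not_liveHeredityFromGAt_of_live_subfloor hk hP hR hQ s hs hcl hu0 hE hsub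

/-- **`H_sub^live(tuned, k)`, `k ≥ 1` → the repaired tuned pair `LiveHeredityAtOneT ∧ LiveHeredityFromTwoT` fails.**
[cite: Sohr2001, Ch. V Thm. 1.5.1] -/
theorem liveHeredity_pairT_false_of_live_subfloor (hk : 1 ≤ k) (hP : S.Pins 8 (6 / 5)) (hR : S.Rigid)
    (hQ : S.Quiet) (s : Stage 1 TowerRates.tuned S (Margins.routeG TowerRates.tuned) k)
    (hs : LiveStageAt TowerRates.tuned S s)
    (hcl : IsClassicalNSSolutionOn (Icc 0 (S.τ (k + 1))) 1 S.f u p) (hu0 : u 0 = S.u₀)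
    (hE : ∃ C : ℝ≥0∞, C < ⊤ ∧ ∀ t ∈ Icc 0 (S.τ (k + 1)), ∫⁻ x, ‖u t x‖ₑ ^ 2 ≤ C)
    (hsub : ∀ x, ‖x‖ ≤ S.radius → ‖u (S.τ (k + 1)) x‖ < S.c₁ * TowerRates.tuned.Y (k + 1)) :
    ¬ (LiveHeredityAtOneT ∧ LiveHeredityFromTwoT) :=
  not_liveHeredity_pair_of_live_subfloor hk hP hR hQ s hs hcl hu0 hE hsub

end Tuned

end Summit.NavierStokesRegularity.HeredityAtOneTLiveSubfloor

end
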